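import Summits.CriticalPhenomena.PercolationContinuityZ3.Theorems.Transplant.SkelFrmBChoiceRootLanding
import Summits.CriticalPhenomena.PercolationContinuityZ3.Theorems.Transplant.SkelFrmBParamsCorrKGLen3
import Summits.CriticalPhenomena.PercolationContinuityZ3.Theorems.Transplant.SkelFrmBParamsCorrKGLenY
import Summits.CriticalPhenomena.PercolationContinuityZ3.Theorems.Transplant.SkelFrmBChoiceReadNums
import Summits.CriticalPhenomena.PercolationContinuityZ3.Theorems.Transplant.SkelPhiCorridorKGYMonoW
import HarnessLib

/-!
# N2 (frames-only node `SamePDropOfSkeletonFrm₁`, OPEN), (R) column SECOND axis — **(R-46): THE ROOT'S y′-CORRIDOR ORIGIN AND ACROSS WINDOW**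
# (`PlanarSkeletonFrm.NegB.KS.X2R / WxYR / Y2R / D2R`; `X2R_add_WxYR` (same core-0 east edge as (C)), `rows_c₂_zero` (origin on the shear line ⇒ the
# along target is stmt's `kgTgtY0` verbatim), `exists_landing2`, **`hxrow_R`** (p358645's east-clearance rows for `k ≤ 28`), and — at stmt's rows
# `kgYRows0_of mk qxY WxY` (C) vs `kgYRows0_of mk qxY WxYR` (root), SAME along slot and run length `kgNYv0` — `farY_R_le` / `farY_R_fits` (the (C)
# run length fits the root), **`ctr2Y_R_le / le_ctr2Y_R`** (CREEP MATCHING: `2·X2R + kgCtr2Y^R` is within `n_L + dec₁Y − 1` of `kgCtr2Y^C`),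
# `hw2Y_R_le` (spread), `ZY_R_le` (depth extents), `schedLenY_R_le` / `kgSchedNRY_le_LfQ3` (length)).
WHY (J24/(R-46), lane INBOX 2026-08-23T12:17:36Z + erratum 12:20:55Z, p3-g17): the y′-corridor's arrival is forward-parked at its core-0 EAST edge
`+ (N+1)v`, and the creep of record `c 1` IS the reading of (C)'s arrival; the root must clear the seed to the EAST (`hclear₃`), so it runs from an
origin `c₂ := t + (X2R, Y2R)` with the SMALLER across window `W^R := kgWY WxYR`, `X2R + W^R = W_Y`, everything else (C)'s — then its arrival box
is (C)'s up to `± 1.5·n_L` across and `≤ sL` rows along (SkelPhiCorridorKGYMonoW).  Generic in the (C) residuals `(qxY, WxY)` under the floor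
`Rs + 34·n_L + 29·R′0 + 2 ≤ WxY` (holds at `WxYQ3 = 81·n_L`); rows-clearance threshold `k₀ := 28` ((R-46)(f)/(g), lane INBOX 12:33Z).
builds on p205010 (kernel theorem, internal audit signed; external expert review pending) — nothing in this file uses p205010; nothing here is a
claim about the open node `SamePDropOfSkeletonFrm₁`.
Lane `prim-bschramm`, seat `prim-bschramm-p3` (gen 17; (R) lineage); helper file (`--supports stmt-CriticalPhenomena-4575 --as helper`).
[cite: KozmaNitzan2024, §4 Lemma 12 (pp. 23–25: the target box of a corridor), p. 28 ((32) at the root)] [cite: MartineauTassion2017, §4.3 Lemma 4.2]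
-/

noncomputable section

open scoped Classical

namespace Summit.CriticalPhenomena.PercolationContinuityZ3.Theorems.Transplant

namespace PlanarSkeletonFrm

namespace NegB

open Literature.Probability.Percolation Literature.Probability.LatticeModels SimpleGraph
open Literature.Barriers.CriticalPhenomena (graphBall)
open SkelConc (Consts)
open Skelφ (shearUnit kgSL kgSLY kgP kgΔY kgNY KGYRows kgFarY kgXY kgM₁Y kgM₂Y kgT₁Y kgWm₂Y kgWp₂Y kgZY₀ kgZY₁ kgCtr2Y kgHw2Y kgDec₁Y)
open Neg

namespace KS

/-! ## §1 The origin offset, the root's across residual, the shear-line height -/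

section Defs

variable (κ : Consts) {V : Type} [DecidableEq V] [Countable V] {G : SimpleGraph V} [G.LocallyFinite] (Φ : PlanarSkeletonFrm G) (t : V) (p : unitInterval)
  (D : Skelφ.StepI.DataNS V) (mk g f WxY : ℕ)

/-- **The root's y′-origin x-offset** `X2R := ⌊(WxY + Rs + 34·n_L + 29·R′0)/2⌋ + 1` (`k₀ := 28`: `34 = k₀ + 6`, `29 = k₀ + 1`). [this work] -/
def X2R : ℕ := (WxY + KS.Rs t D mk + 34 * nL κ Φ t p D g f + 29 * KS0.R'0 κ Φ t p D mk) / 2 + 1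

/-- **The root's across residual** `WxYR := WxY − X2R` (so `kgWY WxYR = W_Y − X2R`). [this work] -/
def WxYR : ℕ := WxY - X2R κ Φ t p D mk g f WxY

/-- **The root's y′-origin height** `Y2R := ⌈h_L·X2R/n_L⌉` (the origin sits on the shear line through `t`: `0 ≤ n_L·Y2R − h_L·X2R < n_L`). [this work] -/
def Y2R : ℤ := -((-(hL κ Φ t p D g f * (X2R κ Φ t p D mk g f WxY : ℤ))) / (nL κ Φ t p D g f : ℤ))

/-- The origin's `ℓ₁` depth `D2R := X2R + |Y2R|`. [this work] -/
def D2R : ℕ := X2R κ Φ t p D mk g f WxY + (Y2R κ Φ t p D mk g f WxY).natAbs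

end Defs

/-! ## §2 Rows about the origin -/

section Rows

variable (κ : Consts) {V : Type} [DecidableEq V] [Countable V] {G : SimpleGraph V} [G.LocallyFinite] (Φ : PlanarSkeletonFrm G) (t : V) (p : unitInterval)
  (D : Skelφ.StepI.DataNS V) (mk g f qxY WxY : ℕ)

/-- `X2R ≤ WxY` under the floor, hence **`X2R + WxYR = WxY`** and `kgWY WxYR + X2R = kgWY WxY` (same core-0 east edge). [folklore] -/
theorem X2R_add_WxYR (hWxY : KS.Rs t D mk + 34 * nL κ Φ t p D g f + 29 * KS0.R'0 κ Φ t p D mk + 2 ≤ WxY) :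
    (KS.X2R κ Φ t p D mk g f WxY) + (KS.WxYR κ Φ t p D mk g f WxY) = WxY ∧ (((kgWY κ Φ t p D g f (KS.WxYR κ Φ t p D mk g f WxY)) : ℕ) : ℤ) + (KS.X2R κ Φ t p D mk g f WxY) = (kgWY κ Φ t p D g f WxY) := by
  have hle : (KS.X2R κ Φ t p D mk g f WxY) ≤ WxY := by
    unfold KS.X2R; omega
  have h1 : (KS.X2R κ Φ t p D mk g f WxY) + (KS.WxYR κ Φ t p D mk g f WxY) = WxY := by unfold KS.WxYR; omega
  refine ⟨h1, ?_⟩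
  unfold kgWY
  have : 2 * (nL κ Φ t p D g f) + (KS.WxYR κ Φ t p D mk g f WxY) + (KS.X2R κ Φ t p D mk g f WxY) = 2 * (nL κ Φ t p D g f) + WxY := by omega
  exact_mod_cast this

/-- **The origin sits on the shear line**: `0 ≤ n_L·Y2R − h_L·X2R < n_L`, so `⌊(n_L·Y2R − h_L·X2R)/U⌋ = 0` for `U = n_L + |h_L|`. [folklore] -/
theorem rows_c₂_zero (hN : EqNumL κ Φ t p D g f) :
    0 ≤ (nL κ Φ t p D g f : ℤ) * (KS.Y2R κ Φ t p D mk g f WxY) - (hL κ Φ t p D g f) * ((KS.X2R κ Φ t p D mk g f WxY) : ℤ) ∧ (nL κ Φ t p D g f : ℤ) * (KS.Y2R κ Φ t p D mk g f WxY) - (hL κ Φ t p D g f) * ((KS.X2R κ Φ t p D mk g f WxY) : ℤ) < (nL κ Φ t p D g f : ℤ) ∧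
      ((nL κ Φ t p D g f : ℤ) * (KS.Y2R κ Φ t p D mk g f WxY) - (hL κ Φ t p D g f) * ((KS.X2R κ Φ t p D mk g f WxY) : ℤ)) / (shearUnit (nL κ Φ t p D g f) (hL κ Φ t p D g f) : ℤ) = 0 := by
  have hn1 : (1 : ℤ) ≤ (nL κ Φ t p D g f : ℤ) := by exact_mod_cast (one_le_of_eqNumL κ Φ t p D g f hN).1
  have hn0 : (0 : ℤ) < (nL κ Φ t p D g f : ℤ) := by linarith
  have hY : (KS.Y2R κ Φ t p D mk g f WxY) = -((-((hL κ Φ t p D g f) * ((KS.X2R κ Φ t p D mk g f WxY) : ℤ))) / (nL κ Φ t p D g f : ℤ)) := rfl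
  have h1 := Int.ediv_mul_le (-((hL κ Φ t p D g f) * ((KS.X2R κ Φ t p D mk g f WxY) : ℤ))) (ne_of_gt hn0)
  have h2 := Int.lt_ediv_add_one_mul_self (-((hL κ Φ t p D g f) * ((KS.X2R κ Φ t p D mk g f WxY) : ℤ))) hn0
  have hlo : 0 ≤ (nL κ Φ t p D g f : ℤ) * (KS.Y2R κ Φ t p D mk g f WxY) - (hL κ Φ t p D g f) * ((KS.X2R κ Φ t p D mk g f WxY) : ℤ) := by rw [hY]; nlinarith
  have hhi : (nL κ Φ t p D g f : ℤ) * (KS.Y2R κ Φ t p D mk g f WxY) - (hL κ Φ t p D g f) * ((KS.X2R κ Φ t p D mk g f WxY) : ℤ) < (nL κ Φ t p D g f : ℤ) := by rw [hY]; nlinarith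
  refine ⟨hlo, hhi, ?_⟩
  have hU : (nL κ Φ t p D g f : ℤ) ≤ (shearUnit (nL κ Φ t p D g f) (hL κ Φ t p D g f) : ℤ) := by
    unfold shearUnit; push_cast
    have := abs_nonneg (hL κ Φ t p D g f)
    have : (((hL κ Φ t p D g f)).natAbs : ℤ) = |(hL κ Φ t p D g f)| := Int.natCast_natAbs _
    linarith
  exact Int.ediv_eq_zero_of_lt hlo (lt_of_lt_of_le hhi hU)

/-- **THE ORIGIN VERTEX EXISTS** (any planar map with unit steps): `c₂ ∈ B_G(t, D2R)` with `ψ c₂ − ψ t = (X2R, Y2R)`. [folklore] -/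
theorem exists_landing2 {ψ : V → Site 2} (hstep : Skelφ.Steps G ψ) :
    ∃ c₂, c₂ ∈ graphBall G t (D2R κ Φ t p D mk g f WxY) ∧ ψ c₂ 0 - ψ t 0 = (((KS.X2R κ Φ t p D mk g f WxY) : ℕ) : ℤ) ∧ ψ c₂ 1 - ψ t 1 = (KS.Y2R κ Φ t p D mk g f WxY) := by
  obtain ⟨c₂, hc, hy⟩ := Skelφ.exists_mem_graphBall_φ_eq hstep t (ψ t + Skelφ.pt (((KS.X2R κ Φ t p D mk g f WxY) : ℕ) : ℤ) (KS.Y2R κ Φ t p D mk g f WxY))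
  have e0 : (ψ t + Skelφ.pt (((KS.X2R κ Φ t p D mk g f WxY) : ℕ) : ℤ) (KS.Y2R κ Φ t p D mk g f WxY)) 0 - ψ t 0 = (((KS.X2R κ Φ t p D mk g f WxY) : ℕ) : ℤ) := by simp
  have e1 : (ψ t + Skelφ.pt (((KS.X2R κ Φ t p D mk g f WxY) : ℕ) : ℤ) (KS.Y2R κ Φ t p D mk g f WxY)) 1 - ψ t 1 = (KS.Y2R κ Φ t p D mk g f WxY) := by simp
  rw [e0, e1] at hc
  have hD : ((((KS.X2R κ Φ t p D mk g f WxY) : ℕ) : ℤ)).natAbs + ((KS.Y2R κ Φ t p D mk g f WxY)).natAbs = D2R κ Φ t p D mk g f WxY := by unfold KS.D2R; simp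
  rw [hD] at hc
  refine ⟨c₂, hc, ?_, ?_⟩
  · have := congrFun hy 0; simp only [Pi.add_apply, Skelφ.pt_zero] at this; linarith
  · have := congrFun hy 1; simp only [Pi.add_apply, Skelφ.pt_one] at this; linarith

/-- **EAST CLEARANCE OF THE LOW RUN REGIONS** (p358645 `clear_of_kgCorrSchedY_rows` / its square-avoidance successor, hypothesis `hxrow`, at `k₀ := 28`): for every `k ≤ 28`,
`Rs < k·v_L − ((n_L + v_L)⁺ + W^R) − (k+1)·R′0 − n_L + X2R` (margin `n_L`). [this work] -/
theorem hxrow_R (hN : EqNumL κ Φ t p D g f) (hWxY : KS.Rs t D mk + 34 * nL κ Φ t p D g f + 29 * KS0.R'0 κ Φ t p D mk + 2 ≤ WxY) :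
    ∀ k : ℕ, k ≤ 28 → (((KS.Rs t D mk) : ℕ) : ℤ) < (k : ℤ) * (vL κ Φ t p D g f) - ((((nL κ Φ t p D g f) + (vL κ Φ t p D g f)).toNat + (kgWY κ Φ t p D g f (KS.WxYR κ Φ t p D mk g f WxY)) : ℕ) : ℤ) - ((k : ℤ) + 1) * (((KS0.R'0 κ Φ t p D mk) : ℕ) : ℤ) - (nL κ Φ t p D g f : ℤ) +
      (((KS.X2R κ Φ t p D mk g f WxY) : ℕ) : ℤ) := by
  intro k hk
  obtain ⟨-, hsum⟩ := X2R_add_WxYR κ Φ t p D mk g f WxY hWxY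
  have hv := hN.v_le
  have hvn : -(nL κ Φ t p D g f : ℤ) ≤ (vL κ Φ t p D g f) := by have := neg_abs_le (vL κ Φ t p D g f); linarith
  have hk' : (k : ℤ) ≤ 28 := by exact_mod_cast hk
  have hk0 : (0 : ℤ) ≤ k := by positivity
  have hn0 : (0 : ℤ) ≤ (nL κ Φ t p D g f : ℤ) := by positivity
  have hR0 : (0 : ℤ) ≤ (((KS0.R'0 κ Φ t p D mk) : ℕ) : ℤ) := by positivity
  have ht : ((((nL κ Φ t p D g f) + (vL κ Φ t p D g f)).toNat : ℕ) : ℤ) ≤ 2 * (nL κ Φ t p D g f : ℤ) := by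
    have h1 : ((((nL κ Φ t p D g f) + (vL κ Φ t p D g f)).toNat : ℕ) : ℤ) = max ((nL κ Φ t p D g f : ℤ) + (vL κ Φ t p D g f)) 0 := Int.toNat_eq_max _
    rw [h1]
    have := le_abs_self (vL κ Φ t p D g f)
    exact max_le (by linarith) (by linarith)
  have hX : (WxY : ℤ) + (KS.Rs t D mk) + 34 * (nL κ Φ t p D g f : ℤ) + 29 * (((KS0.R'0 κ Φ t p D mk) : ℕ) : ℤ) + 1 ≤ 2 * (((KS.X2R κ Φ t p D mk g f WxY) : ℕ) : ℤ) := by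
    have : WxY + (KS.Rs t D mk) + 34 * (nL κ Φ t p D g f) + 29 * (KS0.R'0 κ Φ t p D mk) + 1 ≤ 2 * (KS.X2R κ Φ t p D mk g f WxY) := by unfold KS.X2R; omega
    exact_mod_cast this
  have hW : (((kgWY κ Φ t p D g f WxY) : ℕ) : ℤ) = 2 * (nL κ Φ t p D g f : ℤ) + WxY := by unfold kgWY; push_cast; ring
  have hkv : -(28 * (nL κ Φ t p D g f : ℤ)) ≤ (k : ℤ) * (vL κ Φ t p D g f) := by nlinarith
  have hkR : ((k : ℤ) + 1) * (((KS0.R'0 κ Φ t p D mk) : ℕ) : ℤ) ≤ 29 * (((KS0.R'0 κ Φ t p D mk) : ℕ) : ℤ) := by nlinarith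
  push_cast
  linarith

/-! ## §3 The root's corridor against (C)'s: same along slot and run length, smaller across window -/

/-- `kgWY WxYR ≤ kgWY WxY`. [folklore] -/
theorem kgWY_R_le : (kgWY κ Φ t p D g f (KS.WxYR κ Φ t p D mk g f WxY)) ≤ (kgWY κ Φ t p D g f WxY) := by
  unfold kgWY KS.WxYR; omega

/-- **The root's arrival far edge is at most (C)'s** at every run length. [this work] -/
theorem farY_R_le (hN : EqNumL κ Φ t p D g f) (hg : gFloorKG κ Φ t p D mk ≤ g) (N : ℕ) :
    (kgFarY (nL κ Φ t p D g f) (ℓL κ Φ t p D g f) (hL κ Φ t p D g f) (vL κ Φ t p D g f) (kgR κ Φ t p D mk) 0 (kgqY κ Φ t p D g f qxY) (kgWY κ Φ t p D g f (KS.WxYR κ Φ t p D mk g f WxY)) N) ≤ (kgFarY (nL κ Φ t p D g f) (ℓL κ Φ t p D g f) (hL κ Φ t p D g f) (vL κ Φ t p D g f) (kgR κ Φ t p D mk) 0 (kgqY κ Φ t p D g f qxY) (kgWY κ Φ t p D g f WxY) N) :=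
  (kgYRows0_of κ Φ t p D g f mk qxY (KS.WxYR κ Φ t p D mk g f WxY) hN hg).kgFarY_mono_qW le_rfl (kgWY_R_le κ Φ t p D mk g f WxY) N

/-- **The run length of record fits the root's corridor**: `kgFarY^R (kgNYv0) ≤ kgTgtY0`, given that one (C) run step fits (`h0`, stmt's
`kgFarY … 0 ≤ kgTgtY0` row, supplied as a hypothesis to stay window-generic). [this work] -/
theorem farY_R_fits (hN : EqNumL κ Φ t p D g f) (hg : gFloorKG κ Φ t p D mk ≤ g)
    (h0 : (kgFarY (nL κ Φ t p D g f) (ℓL κ Φ t p D g f) (hL κ Φ t p D g f) (vL κ Φ t p D g f) (kgR κ Φ t p D mk) 0 (kgqY κ Φ t p D g f qxY) (kgWY κ Φ t p D g f WxY) 0) ≤ (kgTgtY0 κ Φ t p D g f mk)) :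
    (kgFarY (nL κ Φ t p D g f) (ℓL κ Φ t p D g f) (hL κ Φ t p D g f) (vL κ Φ t p D g f) (kgR κ Φ t p D mk) 0 (kgqY κ Φ t p D g f qxY) (kgWY κ Φ t p D g f (KS.WxYR κ Φ t p D mk g f WxY)) (kgNYv0 κ Φ t p D g f mk qxY WxY)) ≤ (kgTgtY0 κ Φ t p D g f mk) := by
  have HC := kgYRows0_of κ Φ t p D g f mk qxY WxY hN hg
  have h1 := (HC.kgNY_spec h0).1
  exact (farY_R_le κ Φ t p D mk g f qxY WxY hN hg _).trans h1

/-- **CREEP MATCHING, upper side**: `kgCtr2Y^C − (2·X2R + kgCtr2Y^R) ≤ n_L + dec₁Y − 1` at every `N` (the windows' east edges coincide; the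
`m₁Y` difference costs `2Δm₁·R′0 ≤ n_L` under `40K·R′0 + 1 ≤ n_L`, `WxY ≤ 100·n_L`; `|ΔE₁Y| < dec₁Y`). [this work] -/
theorem ctr2Y_R_le (hN : EqNumL κ Φ t p D g f) (hg : gFloorKG κ Φ t p D mk ≤ g) (hg2 : 40 * Neg.K κ * KS0.R'0 κ Φ t p D mk ≤ g) (hWxY : KS.Rs t D mk + 34 * nL κ Φ t p D g f + 29 * KS0.R'0 κ Φ t p D mk + 2 ≤ WxY)
    (hWx : WxY ≤ 100 * nL κ Φ t p D g f) (N : ℕ) :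
    (kgCtr2Y (nL κ Φ t p D g f) (vL κ Φ t p D g f) (kgR κ Φ t p D mk) 0 (kgWY κ Φ t p D g f WxY) N) - (2 * (((KS.X2R κ Φ t p D mk g f WxY) : ℕ) : ℤ) + (kgCtr2Y (nL κ Φ t p D g f) (vL κ Φ t p D g f) (kgR κ Φ t p D mk) 0 (kgWY κ Φ t p D g f (KS.WxYR κ Φ t p D mk g f WxY)) N)) ≤ (nL κ Φ t p D g f : ℤ) + (kgDec₁Y (nL κ Φ t p D g f) (kgR κ Φ t p D mk) 0) - 1 := by
  have HC := kgYRows0_of κ Φ t p D g f mk 0 WxY hN hg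
  have HR := kgYRows0_of κ Φ t p D g f mk 0 (KS.WxYR κ Φ t p D mk g f WxY) hN hg
  have hup := HR.kgCtr2Y_sub_le HC N
  have hm := HR.kgM₁Y_sub_mul_le HC N
  have hmono := HR.kgM₁Y_monoW (kgWY_R_le κ Φ t p D mk g f WxY) N
  obtain ⟨-, hsum⟩ := X2R_add_WxYR κ Φ t p D mk g f WxY hWxY
  obtain ⟨hKR, -, -, -, hK, -⟩ := valsQ_floor κ Φ t p D g f mk hN hg hg2
  have hd := HR.dec₁_pos.1
  have eR : (kgR κ Φ t p D mk) = (KS0.R'0 κ Φ t p D mk) := rfl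
  have hX2 : (((KS.X2R κ Φ t p D mk g f WxY) : ℕ) : ℤ) ≤ WxY := by
    have := (X2R_add_WxYR κ Φ t p D mk g f WxY hWxY).1
    have : (KS.X2R κ Φ t p D mk g f WxY) ≤ WxY := by omega
    exact_mod_cast this
  have hWx' : ((WxY : ℕ) : ℤ) ≤ 100 * (nL κ Φ t p D g f : ℤ) := by exact_mod_cast hWx
  have hmono' : (((kgM₁Y (nL κ Φ t p D g f) (vL κ Φ t p D g f) (kgR κ Φ t p D mk) 0 (kgWY κ Φ t p D g f (KS.WxYR κ Φ t p D mk g f WxY)) N) : ℕ) : ℤ) ≤ (((kgM₁Y (nL κ Φ t p D g f) (vL κ Φ t p D g f) (kgR κ Φ t p D mk) 0 (kgWY κ Φ t p D g f WxY) N) : ℕ) : ℤ) := by exact_mod_cast hmono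
  have hdec : (kgDec₁Y (nL κ Φ t p D g f) (kgR κ Φ t p D mk) 0) = (nL κ Φ t p D g f : ℤ) - 2 * (((kgR κ Φ t p D mk) : ℕ) : ℤ) - ((0 : ℕ) : ℤ) := rfl
  have hR0 : (0 : ℤ) ≤ (((kgR κ Φ t p D mk) : ℕ) : ℤ) := by positivity
  -- with Δ := m₁^C − m₁^R ≥ 0:  dec₁·Δ ≤ 2(W^C − W^R) + dec₁ − 1 = 2·X2R + dec₁ − 1 ≤ 201·n;  dec₁ ≥ n − 2R′;  1600R′ ≤ n  ⇒  2R′Δ ≤ n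
  have hW2 : 2 * (((((kgWY κ Φ t p D g f WxY) : ℕ) : ℤ)) - (((kgWY κ Φ t p D g f (KS.WxYR κ Φ t p D mk g f WxY)) : ℕ) : ℤ)) = 2 * (((KS.X2R κ Φ t p D mk g f WxY) : ℕ) : ℤ) := by linarith
  have hm' : ((nL κ Φ t p D g f : ℤ) - 2 * (((kgR κ Φ t p D mk) : ℕ) : ℤ)) * ((((kgM₁Y (nL κ Φ t p D g f) (vL κ Φ t p D g f) (kgR κ Φ t p D mk) 0 (kgWY κ Φ t p D g f WxY) N) : ℕ) : ℤ) - (((kgM₁Y (nL κ Φ t p D g f) (vL κ Φ t p D g f) (kgR κ Φ t p D mk) 0 (kgWY κ Φ t p D g f (KS.WxYR κ Φ t p D mk g f WxY)) N) : ℕ) : ℤ)) ≤ 201 * (nL κ Φ t p D g f : ℤ) := by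
    rw [hdec] at hm; push_cast at hm; nlinarith
  have h1600 : 1600 * (((kgR κ Φ t p D mk) : ℕ) : ℤ) + 1 ≤ (nL κ Φ t p D g f : ℤ) := by rw [eR]; nlinarith
  have hprod : 2 * ((((kgR κ Φ t p D mk) : ℕ) : ℤ) * ((((kgM₁Y (nL κ Φ t p D g f) (vL κ Φ t p D g f) (kgR κ Φ t p D mk) 0 (kgWY κ Φ t p D g f WxY) N) : ℕ) : ℤ) - (((kgM₁Y (nL κ Φ t p D g f) (vL κ Φ t p D g f) (kgR κ Φ t p D mk) 0 (kgWY κ Φ t p D g f (KS.WxYR κ Φ t p D mk g f WxY)) N) : ℕ) : ℤ))) ≤ (nL κ Φ t p D g f : ℤ) := by nlinarith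
  rw [hdec] at hup ⊢
  push_cast at hup ⊢
  nlinarith

/-- **CREEP MATCHING, lower side**: `−(dec₁Y − 1) ≤ kgCtr2Y^C − (2·X2R + kgCtr2Y^R)`. [this work] -/
theorem le_ctr2Y_R (hN : EqNumL κ Φ t p D g f) (hg : gFloorKG κ Φ t p D mk ≤ g) (hWxY : KS.Rs t D mk + 34 * nL κ Φ t p D g f + 29 * KS0.R'0 κ Φ t p D mk + 2 ≤ WxY) (N : ℕ) :
    -((kgDec₁Y (nL κ Φ t p D g f) (kgR κ Φ t p D mk) 0) - 1) ≤ (kgCtr2Y (nL κ Φ t p D g f) (vL κ Φ t p D g f) (kgR κ Φ t p D mk) 0 (kgWY κ Φ t p D g f WxY) N) - (2 * (((KS.X2R κ Φ t p D mk g f WxY) : ℕ) : ℤ) + (kgCtr2Y (nL κ Φ t p D g f) (vL κ Φ t p D g f) (kgR κ Φ t p D mk) 0 (kgWY κ Φ t p D g f (KS.WxYR κ Φ t p D mk g f WxY)) N)) := by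
  have HC := kgYRows0_of κ Φ t p D g f mk 0 WxY hN hg
  have HR := kgYRows0_of κ Φ t p D g f mk 0 (KS.WxYR κ Φ t p D mk g f WxY) hN hg
  have hlo := HR.le_kgCtr2Y_sub HC N
  obtain ⟨-, hsum⟩ := X2R_add_WxYR κ Φ t p D mk g f WxY hWxY
  have hmono := HR.kgM₁Y_monoW (kgWY_R_le κ Φ t p D mk g f WxY) N
  have hmono' : (((kgM₁Y (nL κ Φ t p D g f) (vL κ Φ t p D g f) (kgR κ Φ t p D mk) 0 (kgWY κ Φ t p D g f (KS.WxYR κ Φ t p D mk g f WxY)) N) : ℕ) : ℤ) ≤ (((kgM₁Y (nL κ Φ t p D g f) (vL κ Φ t p D g f) (kgR κ Φ t p D mk) 0 (kgWY κ Φ t p D g f WxY) N) : ℕ) : ℤ) := by exact_mod_cast hmono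
  have hR0 : (0 : ℤ) ≤ (((kgR κ Φ t p D mk) : ℕ) : ℤ) := by positivity
  have hprod : 0 ≤ 2 * (((((kgM₁Y (nL κ Φ t p D g f) (vL κ Φ t p D g f) (kgR κ Φ t p D mk) 0 (kgWY κ Φ t p D g f WxY) N) : ℕ) : ℤ)) - ((kgM₁Y (nL κ Φ t p D g f) (vL κ Φ t p D g f) (kgR κ Φ t p D mk) 0 (kgWY κ Φ t p D g f (KS.WxYR κ Φ t p D mk g f WxY)) N) : ℕ)) * ((((kgR κ Φ t p D mk) : ℕ) : ℤ) + ((0 : ℕ) : ℤ)) := by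
    push_cast; nlinarith
  linarith

/-- **SPREAD**: `kgHw2Y^R ≤ kgHw2Y^C + dec₁Y − 1`. [this work] -/
theorem hw2Y_R_le (hN : EqNumL κ Φ t p D g f) (hg : gFloorKG κ Φ t p D mk ≤ g) (N : ℕ) :
    (kgHw2Y (nL κ Φ t p D g f) (ℓL κ Φ t p D g f) (hL κ Φ t p D g f) (vL κ Φ t p D g f) (kgR κ Φ t p D mk) 0 (kgqY κ Φ t p D g f qxY) (kgWY κ Φ t p D g f (KS.WxYR κ Φ t p D mk g f WxY)) N) ≤ (kgHw2Y (nL κ Φ t p D g f) (ℓL κ Φ t p D g f) (hL κ Φ t p D g f) (vL κ Φ t p D g f) (kgR κ Φ t p D mk) 0 (kgqY κ Φ t p D g f qxY) (kgWY κ Φ t p D g f WxY) N) + (kgDec₁Y (nL κ Φ t p D g f) (kgR κ Φ t p D mk) 0) - 1 :=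
  (kgYRows0_of κ Φ t p D g f mk qxY (KS.WxYR κ Φ t p D mk g f WxY) hN hg).kgHw2Y_le_of_le_qW (kgYRows0_of κ Φ t p D g f mk qxY WxY hN hg) le_rfl
    (kgWY_R_le κ Φ t p D mk g f WxY) N

/-- **DEPTH EXTENTS**: `ZY₀^R ≤ ZY₀^C + dec₁Y − 1` and `ZY₁^R ≤ ZY₁^C`. [this work] -/
theorem ZY_R_le (hN : EqNumL κ Φ t p D g f) (hg : gFloorKG κ Φ t p D mk ≤ g) (N : ℕ) :
    (kgZY₀ (nL κ Φ t p D g f) (vL κ Φ t p D g f) (kgR κ Φ t p D mk) 0 (kgWY κ Φ t p D g f (KS.WxYR κ Φ t p D mk g f WxY)) N (kgM₁Y (nL κ Φ t p D g f) (vL κ Φ t p D g f) (kgR κ Φ t p D mk) 0 (kgWY κ Φ t p D g f (KS.WxYR κ Φ t p D mk g f WxY)) N) (kgWm₂Y (nL κ Φ t p D g f) (vL κ Φ t p D g f) (kgR κ Φ t p D mk) 0 (kgWY κ Φ t p D g f (KS.WxYR κ Φ t p D mk g f WxY)) N) (kgWp₂Y (nL κ Φ t p D g f) (vL κ Φ t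 p D g f) (kgR κ Φ t p D mk) 0 (kgWY κ Φ t p D g f (KS.WxYR κ Φ t p D mk g f WxY)) N) (kgM₂Y (nL κ Φ t p D g f) (ℓL κ Φ t p D g f) (hL κ Φ t p D g f) (vL κ Φ t p D g f) (kgR κ Φ t p D mk) 0 (kgqY κ Φ t p D g f qxY) (kgWY κ Φ t p D g f (KS.WxYR κ Φ t p D mk g f WxY)) N)) ≤ (kgZY₀ (nL κ Φ t p D g f) (vL κ Φ t p D g f) (kgR κ Φ t p D mk) 0 (kgWY κ Φ t p D g f WxY) N (kgM₁Y (nL κ Φ t p D g f) (vL κ Φ t p D g f) (kgR κ Φ t p D mk) 0 (kgWY κ Φ t p D g f WxY) N) (kgWm₂Y (nL κ Φ t p D g f) (vL κ Φ t p D g f) (kgR κ Φ t p D mk) 0 (kgWY κ Φ t p D g f WxY) N) (kgWp₂Y (nL κ Φ t p D g f) (vL κ Φ t p D g f) (kgR κ Φ t p D mk) 0 (kgWY κ Φ t p D g f WxY) N) (kgM₂Y (nL κ Φ t p D g f) (ℓL κ Φ t p D g f) (hL κ Φ t p D g f) (vL κ Φ t p D g f) (kgR κ Φ t p D mk) 0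 (kgqY κ Φ t p D g f qxY) (kgWY κ Φ t p D g f WxY) N)) + (kgDec₁Y (nL κ Φ t p D g f) (kgR κ Φ t p D mk) 0) - 1 ∧
    (kgZY₁ (nL κ Φ t p D g f) (ℓL κ Φ t p D g f) (hL κ Φ t p D g f) (kgR κ Φ t p D mk) 0 (kgqY κ Φ t p D g f qxY) N (kgM₁Y (nL κ Φ t p D g f) (vL κ Φ t p D g f) (kgR κ Φ t p D mk) 0 (kgWY κ Φ t p D g f (KS.WxYR κ Φ t p D mk g f WxY)) N) (kgM₂Y (nL κ Φ t p D g f) (ℓL κ Φ t p D g f) (hL κ Φ t p D g f) (vL κ Φ t p D g f) (kgR κ Φ t p D mk) 0 (kgqY κ Φ t p D g f qxY) (kgWY κ Φ t p D g f (KS.WxYR κ Φ t p D mk g f WxY)) N)) ≤ (kgZY₁ (nL κ Φ t p D g f) (ℓL κ Φ t p D g f) (hL κ Φ t p D g f) (kgR κ Φ t p D mk) 0 (kgqY κ Φ t p D g f qxY) N (kgM₁Y (nL κ Φ t p D g f) (vL κ Φ t p D g f) (kgR κ Φ t p D mk) 0 (kgWY κ Φ t p D g f WxY) N) (kgM₂Y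 (nL κ Φ t p D g f) (ℓL κ Φ t p D g f) (hL κ Φ t p D g f) (vL κ Φ t p D g f) (kgR κ Φ t p D mk) 0 (kgqY κ Φ t p D g f qxY) (kgWY κ Φ t p D g f WxY) N)) := by
  have HC := kgYRows0_of κ Φ t p D g f mk qxY WxY hN hg
  have HR := kgYRows0_of κ Φ t p D g f mk qxY (KS.WxYR κ Φ t p D mk g f WxY) hN hg
  exact ⟨HR.kgZY₀_le_of_le_qW HC le_rfl (kgWY_R_le κ Φ t p D mk g f WxY) N, HR.kgZY₁_mono_qW le_rfl (kgWY_R_le κ Φ t p D mk g f WxY) N⟩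

/-- **LENGTH**: the root's y′-schedule is at most as long as (C)'s at every run length. [this work] -/
theorem schedLenY_R_le (hN : EqNumL κ Φ t p D g f) (hg : gFloorKG κ Φ t p D mk ≤ g) (N : ℕ) :
    N + 1 + ((kgM₁Y (nL κ Φ t p D g f) (vL κ Φ t p D g f) (kgR κ Φ t p D mk) 0 (kgWY κ Φ t p D g f (KS.WxYR κ Φ t p D mk g f WxY)) N) + 1) + ((kgM₂Y (nL κ Φ t p D g f) (ℓL κ Φ t p D g f) (hL κ Φ t p D g f) (vL κ Φ t p D g f) (kgR κ Φ t p D mk) 0 (kgqY κ Φ t p D g f qxY) (kgWY κ Φ t p D g f (KS.WxYR κ Φ t p D mk g f WxY)) N) + 1) ≤ N + 1 + ((kgM₁Y (nL κ Φ t p D g f) (vL κ Φ t p D g f) (kgR κ Φ t p D mk) 0 (kgWY κ Φ t p D g f WxY) N) + 1) + ((kgM₂Y (nL κ Φ t p D g f) (ℓL κ Φ t p D g f) (hL κ Φ t p D g f) (vL κ Φ t p D g f) (kgR κ Φ t p D mk) 0 (kgqY κ Φ t p D g f qxY) (kgWY κ Φ t p D g f WxY) N) + 1) :=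
  (kgYRows0_of κ Φ t p D g f mk qxY (KS.WxYR κ Φ t p D mk g f WxY) hN hg).kgSchedLenY_mono_qW le_rfl (kgWY_R_le κ Φ t p D mk g f WxY) N

/-- **`≤ LfQ κ.K₀`** at `kgNYv0` under the residual floors of record `KGResY3` (stmt `kgSchedNY_le_LfQ3`). [this work] -/
theorem kgSchedNRY_le_LfQ3 (hN : EqNumL κ Φ t p D g f) (hg : gFloorKG κ Φ t p D mk ≤ g) (hx : KGResY3 κ Φ t p D g f qxY WxY) :
    (kgNYv0 κ Φ t p D g f mk qxY WxY) + 1 + ((kgM₁Y (nL κ Φ t p D g f) (vL κ Φ t p D g f) (kgR κ Φ t p D mk) 0 (kgWY κ Φ t p D g f (KS.WxYR κ Φ t p D mk g f WxY)) (kgNYv0 κ Φ t p D g f mk qxY WxY)) + 1) + ((kgM₂Y (nL κ Φ t p D g f) (ℓL κ Φ t p D g f) (hL κ Φ t p D g f) (vL κ Φ t p D g f) (kgR κ Φ t p D mk) 0 (kgqY κ Φ t p D g f qxY) (kgWY κ Φ t p D g f (KS.WxYR κ Φ t p D mk g f WxY)) (kgNYv0 κ Φ t p D g f mk qxY WxY))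 + 1) ≤ LfQ κ.K₀ :=
  (schedLenY_R_le κ Φ t p D mk g f qxY WxY hN hg _).trans (kgSchedNY_le_LfQ3 κ Φ t p D g f mk qxY WxY hN hg hx)

end Rows

end KS

end NegB

end PlanarSkeletonFrm

end Summit.CriticalPhenomena.PercolationContinuityZ3.Theorems.Transplant

end
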